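import Mathlib
import Summits.KontsevichZagierPeriods.Zeta5Search.Families.CubicalChartVIMLive
import Summits.KontsevichZagierPeriods.Zeta5Search.Families.CoeffAsympMain
import HarnessLib

/-!
# ζ(5) search — the growth exponent of the `M_{0,10}` leading coefficients `A(n)` EXISTS: a variational (dual-cell) expression

HONEST FRAMING: systematic search; no irrationality claim unless certified.  Cell `pub-zeta5`, certifier 2 (cert-2 g10,
2026-08-22).  Elementary real analysis of the coefficients of powers of a polynomial with non-negative coefficients; nothing
about `ζ(5)` or `ζ(7)`; no number of record moves; no conjecture node is used.

WHAT.  By `Families/CubicalChartVIM` the leading coefficients `A(n)` of Brown–Zudilin's "vanishing in the middle" forms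
([BrownZudilin2022, §12]; fam-brown9) are the coefficients `[g^{n·𝟙}] P₁ⁿ` of the powers of ONE polynomial with non-negative
integer coefficients, `P₁ = vimSpanProd (1,…,1)` (the product of the eight chord polynomials of the dual cell, eight gap
variables).  cert-2 g9's coefficient-asymptotics engine (`Families/CoeffAsympMain.tendsto_log_coeff_pow_div`: method of types +
tilted measure) therefore gives
* **`tendsto_log_A_div`**: `log A(n) / n → log ⨅_{u ∈ ℝ⁸} Σ_α [g^α]P₁ · e^{(α − 𝟙)·u}` (`= log min_{g > 0} P₁(g)/g^𝟙`, the
  logarithm of the minimum of the dual-cell Laurent polynomial over the positive orthant) — the growth exponent of the VIM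
  leading coefficients exists and is this variational number; `vimRate_arg_pos` (the infimum is `> 0`, indeed `≥ [g^𝟙]P₁ = 61`).
What is NOT proved here: the identification of this infimum with `λ₄ = 1/vimSup = 6329.26…`, the largest root of the
characteristic polynomial of the cell's PROVED order-4 recurrence (`Certificates/VIML3Holds`, `Families/CellularVIMExact`) — that
is the VIM analogue of cert-2 g9's `recordQRate_eq_neg_log_raySup_dual` and needs the dual-cell dictionary for `σ = vim10`
(numerically, `HOME/cert-2/g10/code/c7_vim_selfdual.py`: `min_{g>0} P₁(g)/g^𝟙 = 6329.2605… = λ₄`, `log = 8.75293869` =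
fam-brown9's exact-anchored `b̂` of the diagonal).  Standard axioms only.
-/

noncomputable section

open Finset Real Filter Topology

namespace Summit.KontsevichZagierPeriods.Zeta5Search.Families.Cellular

namespace CubicalChartN

open Summit.KontsevichZagierPeriods.Zeta5Search.Cells.VanishingMiddleLeading (balanced_basic)
open Summit.KontsevichZagierPeriods.Zeta5Search.Families.CellularVIMRecurrenceLaws (A)

/-- The VIM dual-cell polynomial `P₁ = vimSpanProd (1,…,1)` with REAL coefficients. -/
def vimPolyR : MvPolynomial (Fin 8) ℝ := MvPolynomial.map (Int.castRingHom ℝ) (vimSpanProd (Cells.VanishingMiddleLeading.basic 1))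

/-- The all-ones exponent vector of the eight gaps. -/
def onesGap : Fin 8 →₀ ℕ := Finsupp.equivFunOnFinite.symm fun _ => 1

/-- `vimSpanProd (n,…,n) = P₁ⁿ`. -/
theorem vimSpanProd_basic (n : ℕ) : vimSpanProd (Cells.VanishingMiddleLeading.basic n) = vimSpanProd (Cells.VanishingMiddleLeading.basic 1) ^ n := by
  unfold vimSpanProd Cells.VanishingMiddleLeading.basic
  simp only [pow_one, mul_pow]

/-- The gap exponents of the Cells.VanishingMiddleLeading.basic member are `n·𝟙`. -/
theorem vimGap_basic (n : ℕ) : Finsupp.equivFunOnFinite.symm (vimGap (Cells.VanishingMiddleLeading.basic n)) = n • onesGap := by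
  ext w
  simp only [Finsupp.coe_equivFunOnFinite_symm, onesGap, Finsupp.coe_smul, Pi.smul_apply, smul_eq_mul, mul_one]
  fin_cases w <;> rfl

/-- **`A(n) = [g^{n·𝟙}] P₁ⁿ`** (real coefficients). -/
theorem A_eq_coeff_pow (n : ℕ) : (A n : ℝ) = MvPolynomial.coeff (n • onesGap) (vimPolyR ^ n) := by
  rw [A_eq_vimDualCT, vimDualCT, vimGap_basic, vimSpanProd_basic, vimPolyR, ← map_pow, MvPolynomial.coeff_map]
  simp

/-- `P₁` has non-negative coefficients. -/
theorem coeff_vimPolyR_nonneg (m : Fin 8 →₀ ℕ) : 0 ≤ MvPolynomial.coeff m vimPolyR := by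
  rw [vimPolyR, MvPolynomial.coeff_map, vimSpanProd_eq_spanProd, eq_intCast]
  exact_mod_cast SpanHall.coeff_spanProd_nonneg vimSpan _ m

/-- `[g^𝟙] P₁ = A(1) = 61 ≠ 0`. -/
theorem coeff_ones_vimPolyR : MvPolynomial.coeff onesGap vimPolyR = 61 := by
  have h := A_eq_coeff_pow 1
  rw [pow_one, one_smul, CellularVIMRecurrenceLaws.A_one] at h
  exact_mod_cast h.symm

/-- **The VIM growth exponent**: `log ⨅_u Σ_α [g^α]P₁ e^{(α−𝟙)·u}`, the variational number of the dual cell. -/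
def vimRate : ℝ := Real.log (⨅ u : Fin 8 → ℝ, CoeffAsymp.tilt vimPolyR.support (fun m => MvPolynomial.coeff m vimPolyR) onesGap u)

/-- **The growth exponent of the VIM leading coefficients exists**: `log A(n) / n → vimRate`. -/
theorem tendsto_log_A_div : Tendsto (fun n : ℕ => Real.log (A n : ℝ) / n) atTop (𝓝 vimRate) := by
  have h := CoeffAsymp.tendsto_log_coeff_pow_div vimPolyR coeff_vimPolyR_nonneg (B := onesGap)
    (by rw [coeff_ones_vimPolyR]; norm_num)
  unfold vimRate
  refine Tendsto.congr (fun n => ?_) h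
  rw [A_eq_coeff_pow]

/-- The infimum is positive (it is at least `[g^𝟙] P₁ = 61`), so `vimRate` is the logarithm of a positive number. -/
theorem vimRate_arg_pos : 0 < ⨅ u : Fin 8 → ℝ, CoeffAsymp.tilt vimPolyR.support (fun m => MvPolynomial.coeff m vimPolyR) onesGap u := by
  have hc : ∀ m ∈ vimPolyR.support, 0 < MvPolynomial.coeff m vimPolyR := fun m hm =>
    lt_of_le_of_ne (coeff_vimPolyR_nonneg m) (Ne.symm (MvPolynomial.mem_support_iff.1 hm))
  have hB : onesGap ∈ vimPolyR.support := MvPolynomial.mem_support_iff.2 (by rw [coeff_ones_vimPolyR]; norm_num)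
  exact CoeffAsymp.iInf_tilt_pos hc hB

end CubicalChartN

end Summit.KontsevichZagierPeriods.Zeta5Search.Families.Cellular
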